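import Summits.ResolutionOfSingularities.ResolutionOfSingularities.Theorems.PAlterationPialtSqueezeRRLU1
import HarnessLib

/-!
# Stub `stub_perfectRes_of_atoms` (crux stmt-ResolutionOfSingularities-0552, line `Sketch` rev. c3)

Glue stub of the skeleton `Sketch` (rev. c3) for the crux `PalterationThesis`
(stmt-ResolutionOfSingularities-0552): the FIELDWISE Zariski–Piltant engine. Over ONE field `K`
of characteristic `p` (no perfectness needed), the three atoms over `K`

* Temkin's inseparable local uniformization over the ground field `K` (`hT`: every valuation
  ring `O ∋ K` of a finitely generated `F/K` becomes locally uniformizable over `K` on some finite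
  purely inseparable `L/F`),
* RRLU1 over `K` (`h1`: local uniformization below height-one Frobenius sandwiches of regular
  affine `K`-varieties), and
* two-model patching of proper models over `K` (`hZ`),

resolve every reduced separated `K`-scheme of finite type.

This is item stmt-0555's `hasResolution_of_temkin2013_of_rrLU1_at_of_twoModelPatching_at`
(`Theorems/PAlterationPialtSqueezeRRLU1.lean`) with the single change that the Temkin hypothesis
is the fieldwise statement over `K` instead of the global named fact `Temkin2013` (whose proof
there is only ever invoked at the ground field): Temkin supplies a finite purely inseparable `L/F`
on which the valuation is uniformized, `exists_regularModel_of_isLocallyUniformizable` a regular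
finitely generated affine model of `L` inside the valuation ring, the descent
`isLocallyUniformizable_comap_of_rrLU1` brings local uniformization down to `F`, and the
Zariski–Piltant engine `resolutionOverUpToDim_of_properPatching_of_lu` patches.
-/

set_option linter.dupNamespace false

noncomputable section

open CategoryTheory AlgebraicGeometry IsLocalRing
open Literature.AlgebraicGeometry.Resolution
open Summit.ResolutionOfSingularities.ResolutionOfSingularities.Theorems.Pialt.RadiciallyRegular

namespace Summit.ResolutionOfSingularities.ResolutionOfSingularities.Theorems.PalterationThesis.PerfectAtoms

/-- **Local uniformization over ONE ground field `K` from Temkin's theorem over `K` and RRLU1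
over `K`.** Temkin's inseparable local uniformization (here a fieldwise hypothesis) gives a finite
purely inseparable `L/F` on which the valuation is uniformized, hence
(`exists_regularModel_of_isLocallyUniformizable`) a regular finitely generated affine model of `L`
inside the valuation ring; the descent `isLocallyUniformizable_comap_of_rrLU1` (which consumes
RRLU1 only for towers over the fixed `K`) brings local uniformization down to `F`.
[cite: Temkin2013, Thm. 1.3.2 and Rem. 1.3.5 (ii)–(iii)] -/
theorem isLocallyUniformizable_of_temkinAt_of_rrLU1_at {p : ℕ} [Fact p.Prime] (K : Type)
    [Field K] [CharP K p]
    (hT : ∀ (F : Type) [Field F] [Algebra K F], (⊤ : IntermediateField K F).FG →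
      ∀ O : ValuationSubring F, (∀ c : K, algebraMap K F c ∈ O) →
        ∃ (L : Type) (_ : Field L) (_ : Algebra F L) (_ : Algebra K L) (_ : IsScalarTower K F L),
          FiniteDimensional F L ∧ IsPurelyInseparable F L ∧
          ∃ O' : ValuationSubring L, O'.comap (algebraMap F L) = O ∧
            IsLocallyUniformizable K L O')
    (h1 : ∀ (F L : Type) [Field F] [Field L] [Algebra K F] [Algebra F L] [Algebra K L]
      [IsScalarTower K F L], (⊤ : IntermediateField K F).FG → IsPurelyInseparable F L →
      (∃ y : L, y ^ p ∈ (algebraMap F L).range ∧ IntermediateField.adjoin F {y} = ⊤) →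
      ∀ B : Subalgebra K L, B.FG → IsFractionRing B L → IsRegularRing B →
      ∀ O : ValuationSubring L, B.toSubring ≤ O.toSubring →
        IsLocallyUniformizable K F (O.comap (algebraMap F L)))
    (F : Type) [Field F] [Algebra K F] (hfg : (⊤ : IntermediateField K F).FG)
    (O : ValuationSubring F) (hO : ∀ c : K, algebraMap K F c ∈ O) :
    IsLocallyUniformizable K F O := by
  -- adapted from `isLocallyUniformizable_of_temkin2013_of_rrLU1_at`
  -- (PAlterationPialtSqueezeRRLU1.lean), with the named fact `Temkin2013` read at `K` only
  obtain ⟨L, _, _, _, _, hfd, hpi, O', hO'O, hLU'⟩ := hT F hfg O hO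
  haveI := hfd
  haveI := hpi
  obtain ⟨B, hBO', hBfg, hBfr, hBreg⟩ := exists_regularModel_of_isLocallyUniformizable K L O' hLU'
  have key := isLocallyUniformizable_comap_of_rrLU1 K h1 (Module.finrank F L) F L le_rfl hfg
    O' B hBfg hBfr hBreg hBO'
  rwa [hO'O] at key

/-- **GLUE STUB `stub_perfectRes_of_atoms` (worker A).** Over a field `K` of characteristic `p`:
Temkin's inseparable local uniformization over `K`, RRLU1 over `K` and two-model patching of
proper models over `K` resolve every reduced separated `K`-scheme of finite type — item 0555's
Zariski–Piltant engine `hasResolution_of_temkin2013_of_rrLU1_at_of_twoModelPatching_at`, made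
fieldwise in Temkin as well (`resolutionOverUpToDim_of_properPatching_of_lu`, fed with
`isLocallyUniformizable_of_temkinAt_of_rrLU1_at`, in the dimension bound
`exists_topologicalKrullDim_le_of_locallyOfFiniteType`).
[cite: Piltant2013, Prop. 5.1 and Cor. 5.7] -/
theorem stub_perfectRes_of_atoms (p : ℕ) (hp : p.Prime) (K : Type) [Field K] [CharP K p]
    (hT : ∀ (F : Type) [Field F] [Algebra K F], (⊤ : IntermediateField K F).FG →
      ∀ O : ValuationSubring F, (∀ c : K, algebraMap K F c ∈ O) →
        ∃ (L : Type) (_ : Field L) (_ : Algebra F L) (_ : Algebra K L) (_ : IsScalarTower K F L),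
          FiniteDimensional F L ∧ IsPurelyInseparable F L ∧
          ∃ O' : ValuationSubring L, O'.comap (algebraMap F L) = O ∧
            IsLocallyUniformizable K L O')
    (h1 : ∀ (F L : Type) [Field F] [Field L] [Algebra K F] [Algebra F L] [Algebra K L]
      [IsScalarTower K F L], (⊤ : IntermediateField K F).FG → IsPurelyInseparable F L →
      (∃ y : L, y ^ p ∈ (algebraMap F L).range ∧ IntermediateField.adjoin F {y} = ⊤) →
      ∀ B : Subalgebra K L, B.FG → IsFractionRing B L → IsRegularRing B →
      ∀ O : ValuationSubring L, B.toSubring ≤ O.toSubring →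
        IsLocallyUniformizable K F (O.comap (algebraMap F L)))
    (hZ : ∀ (F : Type) [Field F] [Algebra K F] [Algebra.EssFiniteType K F],
      ∀ M₁ M₂ : ProperModel K F,
        ∃ (N : ProperModel K F) (φ₁ : N.Hom M₁) (φ₂ : N.Hom M₂), φ₁.RegLe ∧ φ₂.RegLe) :
    ∀ (X : Scheme.{0}) (f : X ⟶ Spec (.of K)),
      IsSeparated f → LocallyOfFiniteType f → QuasiCompact f → IsReduced X →
      Scheme.HasResolution X := by
  -- adapted from `hasResolution_of_temkin2013_of_rrLU1_at_of_twoModelPatching_at`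
  -- (PAlterationPialtSqueezeRRLU1.lean)
  intro X f hs hl hq hr
  haveI := hl
  haveI := hq
  haveI : Fact p.Prime := ⟨hp⟩
  haveI : CompactSpace X := QuasiCompact.compactSpace_of_compactSpace f
  obtain ⟨d, hd⟩ := exists_topologicalKrullDim_le_of_locallyOfFiniteType f
  exact resolutionOverUpToDim_of_properPatching_of_lu hZ
    (fun F _ _ hFfg O hO => isLocallyUniformizable_of_temkinAt_of_rrLU1_at K hT h1 F hFfg O hO)
    d X f hs hl hq hr hd

end Summit.ResolutionOfSingularities.ResolutionOfSingularities.Theorems.PalterationThesis.PerfectAtoms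

end
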